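import Literature.Barriers.BirchSwinnertonDyer.PAdicFunctionalEquationParityProofs
import HarnessLib

/-!
# The `p`-adic functional equation at the conductor level — parity consequences at EVERY prime
# (the case `p = 2` included)

Companion to `PAdicFunctionalEquationParityProofs`. There the named fact
`padicLFunction_functional_equation W p` (Greenberg, LNM 1716, §1, pp. 67–68; Mazur–Tate–Teitelbaum
1986, §I.17) is PROVED at the conductor level (`padicLFunction_functional_equation_conductorLevel`),
and its parity consequences `ord_{T=0} L_p(E,T) ≡ ord_{s=1} L(E,s) (mod 2)`
(`even_order_padicLFunction_iff_even_analyticRank_conductorLevel`) and "simple zero of `L_p` ⇒ odd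
order of `L(E,s)`" (`odd_analyticRank_of_order_padicLFunction_eq_one_conductorLevel`) are derived
— but only for ODD `p`, because they are routed through the named fact, whose statement carries the
binder `p ≠ 2` (inherited from the consumers of Kato's theorem). That binder is idle: the proof of
the functional equation (`padicLFunction_mem_padicFEClass_of_isFrickeEigen`: Fricke symmetry of
the Mazur–Swinnerton-Dyer measure, `-1` being a Teichmüller representative also for `p = 2`) and
the leading-coefficient comparison `w = (-1)^{ord}` (`eq_neg_one_pow_of_subst_eq`: `T^ι = -T + O(T²)`)
hold at every prime. This file records the three statements WITHOUT the parity restriction on `p`: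

* `padicLFunction_mem_padicFEClass_rootNumber_conductorLevel`: for `W/ℚ` elliptic, globally
  minimal, good ordinary at ANY prime `p`, and `f ∈ S₂(Γ₀(N_W))` its newform,
  `L_p(E,T) ∈ padicFEClass (binomialMultipliers p) w_E`, i.e. `L_p(E,T^ι) = w_E (1+T)^c L_p(E,T)`;
* `rootNumber_eq_neg_one_pow_order_padicLFunction_conductorLevel_anyPrime`: `w_E = (-1)^{ord_T L_p(E,T)}`
  (with `L_p ≠ 0`, `padicLFunction_unitRoot_ne_zero`, the first-moment form of Rohrlich's theorem);
* `even_order_padicLFunction_iff_even_analyticRank_conductorLevel_anyPrime` and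
  `odd_analyticRank_of_order_padicLFunction_eq_one_conductorLevel_anyPrime`: the two parity
  consequences at every prime, in particular at a good ordinary `p = 2` (`a_2` odd).

Use: the `p = 2` residue of the Mazur–Tate–Teitelbaum rank clause (route `PAdicOrderV2`, crux
`PAdicOrderPadicBSDrankR2`, line `Sketch`, stub `stub_padicBSDrank_residueTwo`) has the same parity
input as the odd primes; what it lacks is an Euler-system bound at `p = 2`, not the sign.

References: R. Greenberg, LNM 1716 (1999), §1 pp. 67–68 and §5 p. 181 ("(For `p = 2`, we would
have another possibility: `a = -2`.)" concerns the ROOTS of `f_E`, not the sign at `T = 0`);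
B. Mazur, J. Tate, J. Teitelbaum, Invent. Math. 84 (1986), §I.17.
-/

noncomputable section

open scoped MatrixGroups ModularForm

open CongruenceSubgroup PowerSeries WeierstrassCurve
  Literature.NumberTheory.EllipticCurves Literature.NumberTheory.EllipticCurves.ModularForms

namespace Literature.Barriers.BirchSwinnertonDyer

variable {p : ℕ} [Fact p.Prime] {W : WeierstrassCurve ℚ} [W.IsElliptic] [W.IsGloballyMinimal]
  [NeZero (W.conductorNorm ℤ)] {f : CuspForm (Gamma0 (W.conductorNorm ℤ)) 2}

/-- **`L_p(E, T^ι) = w_E (1 + T)^c L_p(E, T)` at the conductor level, for EVERY prime `p`.** For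
`W/ℚ` elliptic and globally minimal, good ordinary at `p` (also `p = 2`), and `f ∈ S₂(Γ₀(N_W))` its
newform: `L_p(E,·) = padicLFunction f (unitRoot W p) ∈ padicFEClass (binomialMultipliers p) w_E`,
`w_E = W.rootNumber`. This is the body of `padicLFunction_functional_equation_conductorLevel`
(whose `p ≠ 2` binder, inherited from the named fact, is never used): `w_E = -ε(f)` at level `N_W`
(`rootNumber_eq_neg_frickeEigenvalue`) and the any-level theorem
`padicLFunction_mem_padicFEClass_of_isFrickeEigen`. Greenberg, LNM 1716, §1: "`L_p(E/ℚ, 2-s) =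
w_E ⟨N_E⟩^{s-1} L_p(E/ℚ, s)`". [cite: GreenbergLNM1716, §1 (functional equation, pp. 67–68)] -/
theorem padicLFunction_mem_padicFEClass_rootNumber_conductorLevel
    (hord : IsOrdinaryAt W p) (hf : IsNewformOf W f) :
    padicLFunction f (unitRoot W p : ℚ_[p]) ∈
      padicFEClass (binomialMultipliers p) (((W.rootNumber : ℤ)) : ℚ_[p]) := by
  have hw : (W.rootNumber : ℂ) = -frickeEigenvalue f :=
    rootNumber_eq_neg_frickeEigenvalue (fun _ _ ↦ IsNewform0.exists_functional_equation_holds)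
      (fun _ _ ↦ IsNewform0.frickeEigenvalue_eq_one_or_eq_neg_one_holds) hf
  have hsm := IsNewform0.frickeInvolution_eq_smul_holds (N := W.conductorNorm ℤ) (k := (2 : ℤ)) hf.1
  have hFE : IsFrickeEigen (W.conductorNorm ℤ) f (frickeEigenvalue f) :=
    isFrickeEigen_of_frickeInvolution_eq_smul _ hsm
  have hW : IsFrickeEigen (W.conductorNorm ℤ) f (-((W.rootNumber : ℤ) : ℂ)) := by
    rw [hw, neg_neg]; exact hFE
  have hσ : W.rootNumber ^ 2 = 1 := by
    rcases W.rootNumber_eq_one_or with h | h <;> rw [h] <;> norm_num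
  exact padicLFunction_mem_padicFEClass_of_isFrickeEigen hσ hW hord hf

/-- **`w_E = (-1)^{ord_{T=0} L_p(E,T)}` at the conductor level, for EVERY prime `p`** (also
`p = 2`): compare leading coefficients in `L_p(E,T^ι) = w_E (1+T)^c L_p(E,T)` using
`T^ι = -T + O(T²)` (`eq_neg_one_pow_of_subst_eq`) and `L_p(E,T) ≠ 0`
(`padicLFunction_unitRoot_ne_zero`). Greenberg, LNM 1716, §5, p. 181: "The 'signs' in the
functional equations for `L_p(E/ℚ, s)` and `L(E/ℚ, s)` are the same."
[cite: GreenbergLNM1716, §5 (p. 181, `λ_E^{anal} = 1` passage)] -/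
theorem rootNumber_eq_neg_one_pow_order_padicLFunction_conductorLevel_anyPrime
    (hord : IsOrdinaryAt W p) (hf : IsNewformOf W f) :
    ((W.rootNumber : ℤ) : ℚ_[p]) =
      (-1) ^ (padicLFunction f (unitRoot W p : ℚ_[p])).order.toNat := by
  obtain ⟨u, hu, hFE'⟩ := padicLFunction_mem_padicFEClass_rootNumber_conductorLevel hord hf
  exact eq_neg_one_pow_of_subst_eq constantCoeff_invOnePlusSubOne coeff_one_invOnePlusSubOne
    (binomialMultipliers_subset_principalUnits p hu) hFE'
    (coe_toNat_order (padicLFunction_unitRoot_ne_zero hord hf)).symm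

/-- **`ord_{T=0} L_p(E, T) ≡ ord_{s=1} L(E, s) (mod 2)` at the conductor level, for EVERY prime
`p`** (also a good ordinary `p = 2`): the theorem
`even_order_padicLFunction_iff_even_analyticRank_conductorLevel` without its idle hypothesis
`p ≠ 2`. Both parities are read off the common sign `w_E = -ε(f)`:
`rootNumber_eq_neg_one_pow_order_padicLFunction_conductorLevel_anyPrime` on the `p`-adic side and
`even_analyticRank_iff_of_isNewformOf_conductorLevel` (Hecke's functional equation) on the complex
side. [cite: GreenbergLNM1716, §5 (p. 181, `λ_E^{anal} = 1` passage)] -/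
theorem even_order_padicLFunction_iff_even_analyticRank_conductorLevel_anyPrime
    (hord : IsOrdinaryAt W p) (hf : IsNewformOf W f) :
    Even (padicLFunction f (unitRoot W p : ℚ_[p])).order.toNat ↔ Even W.analyticRank := by
  have hsign := rootNumber_eq_neg_one_pow_order_padicLFunction_conductorLevel_anyPrime hord hf
  have hpar := even_analyticRank_iff_of_isNewformOf_conductorLevel hf
  have hneg : (-1 : ℚ_[p]) ≠ 1 := by norm_num
  rw [hpar, ← neg_one_pow_eq_one_iff_even hneg, ← hsign]
  constructor
  · intro h; exact_mod_cast h
  · intro h; rw [h]; norm_num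

/-- **Simple zero of `L_p(E,T)` ⇒ odd order of `L(E,s)` at `s = 1`, at the conductor level, for
EVERY prime `p`** (Greenberg's printed instance, LNM 1716, §5, p. 181, without the idle `p ≠ 2` of
`odd_analyticRank_of_order_padicLFunction_eq_one_conductorLevel`).
[cite: GreenbergLNM1716, §5 (p. 181, `λ_E^{anal} = 1` passage)] -/
theorem odd_analyticRank_of_order_padicLFunction_eq_one_conductorLevel_anyPrime
    (hord : IsOrdinaryAt W p) (hf : IsNewformOf W f)
    (h1 : (padicLFunction f (unitRoot W p : ℚ_[p])).order = 1) : Odd W.analyticRank := by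
  rw [← Nat.not_even_iff_odd,
    ← even_order_padicLFunction_iff_even_analyticRank_conductorLevel_anyPrime hord hf, h1]
  decide

end Literature.Barriers.BirchSwinnertonDyer

end
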